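/-
Copyright (c) 2026 the pub-hodgecm-mathlib formalisation cell (harness21).  Prover seat hodgecm-mathlib-LH4-p13 (g6), req620 Track A «(D-RAM) FOUR-FRAME» squad, unit U2H:
the (ρ2b′-X) child `stub_U2H_fixedPointCensus_typeTwo_unit0` (U2H :418) — the SIDE STRUCTURE of the (D3) top cells of type RamK: near cells live on BOTH sides, far cells on
EXACTLY ONE, and that side is CONSTANT along the diagonal (the RK twin of LH4-p06 (g5)'s `…RamMTopLawSide`; «(X-RK) exclusivity», owed seam of MAP v2).  2026-09-04.
-/
import Summits.HodgeConjecture.HodgeConjecture.Theorems.F0P3cDyRamTopDepthRamK   -- ★ p857887 (this seat): `v_eq_one_of_v_sub_one_le`; brings ★ `QuadraticOrderThetaFixedUnits` ((M-RK1) `exists_fixed_fixed_mul_of_eq_fixed_mul`, `v_sub_one_le_of_theta_fixed`) and ★ `WildQuadraticDatumTrace`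
import HarnessLib

/-!
# Crux `H413`, line LH4 «(D-RAM) FOUR-FRAME» — unit U2H, (ρ2b′-X): THE SIDE STRUCTURE OF THE RamK TOP CELLS — near cells: both sides; far cells: one side, constant in depth

Cell `hodgecm-mathlib` (D-0151), FLOOR 0, crux item H413 = `stmt-HodgeConjecture-24833`, route of record `HCCMUnconditional`; squad F0∕P3c∕LH4; registered stub served:
`F0P3cDyRamFourFrameU2H.stub_U2H_fixedPointCensus_typeTwo_unit0` ((ρ2b′-X), U2H :418) through LH4-p14's HEAD-OF-ORGANS, RK branch of the (C0) census — the SECOND conjunct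
`j + a + 2 ≤ m + 2d ∨ ε = side` of ★ p857635 `toricCensusSum_ramK`'s `hvTop`, in the norm-decomposition letters of ★ p857764 ∕ p857819 ∕ p857848 ∕ p857887 (this seat):
for a (D3) unit `z` (hyperbolic `z₊ = μh(α − ρα)∕π`; the other line model's unit is `z₊·n₀·e₀` up to a `ρ`-fixed unit `e₀`, `n₀` a `Θ`-fixed unit NON-norm — ★ B5
`QuadraticDatumAntiFixedUnitSplitting` ∕ (S4)), write TOP(z, c) := `∃ k e w, Θk = k ∧ |k| = 1 ∧ ρe = e ∧ |e| = 1 ∧ |w − 1| ≤ exp(−c) ∧ z = k·e·w` («some side alive», ★ p857887: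
⟺ `c + d ≤ jλ + 1`) and ALIVE(z, c) := `∃ x e w, |x| = 1 ∧ ρe = e ∧ |e| = 1 ∧ |w − 1| ≤ exp(−c) ∧ z = xΘx·e·w` (★ p857848: ⟺ the sheet-v5 BIT).  THEOREMS ONLY (no `def`, no
instance, no notation, no `sorry`); lane `--supports stmt-HodgeConjecture-24833` (count-neutral).

* §1 NEAR CELLS (`alive_of_topDecomp_of_nonNorm_near`): if some `Θ`-fixed non-norm unit `n₀` has `|n₀ − 1| ≤ exp(−c)` (★ `exists_fixed_unit_not_norm_of_level_pow`: such `n₀` exists at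
  every `c ≤ 2d − 2`) then TOP(z, c) ⇒ ALIVE(z, c) — with the unit norm dichotomy (`hdich`, ★ `exists_unit_norm_dichotomy_of_isRamifiedQuadraticDatum`) a non-norm `k` is `N(x)·n₀`, and
  `n₀` is absorbed into `w`.  So near cells are alive on BOTH sides exactly when TOP holds (the `1·q^{…}` value of `hvTop`).
* §2 FAR CELLS, EXCLUSIVITY (`not_alive_and_alive_mul_nonNorm`): for `2d ≤ c + 1`, ALIVE(z, c) and ALIVE(z·n₀·e₀, c) cannot both hold (`n₀` a `Θ`-fixed unit non-norm, `e₀` a `ρ`-fixed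
  unit): their quotient would put `n₀` in `N·(𝒪_{K♮}ˣ ∩ 𝒪_EˣU^{(c)}) = N·𝒪_FˣU_{K♮}^{(⌈c∕2⌉)} ⊆ N` (★ (M-RK1) + `hNF`, `hNd`).  So far cells live on at most one side (the `2·q^{…}` value on
  side `ε` only); with §1's converse direction trivial, TOP ⟺ exactly one side.
* §3 FAR CELLS, CONSTANCY (`alive_of_alive_of_topDecomp`): for `2d ≤ c₁ + 1`, `c₁ ≤ c₂`: ALIVE(z, c₁) ∧ TOP(z, c₂) ⇒ ALIVE(z, c₂) (and ALIVE(z, c₂) ⇒ ALIVE(z, c₁), `alive_mono`) — the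
  side does not change along the diagonal while TOP holds; hence the side at every far depth `≤ D = jλ − d + 1` is the side at the depth `c₀ ≤ m_λ − t` where ★ p857819 §4 makes it
  EXPLICIT (`k = κ_{S9}·π₂^j`, sign `(N_{K♮∕F}k, θ)_v = (x, θ)_v = (β, θ)_v`).
INTERFACE.  `hdich`, `hnn∕n₀` ← ★ `WildQuadraticDatumUnitNormIndexTwo` ∕ `…NonNormUnitLevel` on the datum `(M, Θ, ϖE, d, t)` (`[IsAdicComplete 𝓂[K] 𝒪[K]] [Finite 𝓀[K]]`);
`hNF`, `hNd`, `hΘev`, `hϖE`, `hρϖ`, `hΘϖ` as ★ p857764 ∕ p857819.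
HONEST LABEL.  Count-neutral helper; (ρ2b′-X) OPEN; `HC_CM` is proved only modulo the 7 printed citations (2 remaining named inputs: hLiu418 = `stmt-HodgeConjecture-24832`, h413 =
`stmt-HodgeConjecture-24833`) until rung 0 closes.

## References
* [Serre1979] J.-P. Serre, *Local Fields*, GTM 67 (1979), Ch. V §2 Prop. 3, §3 Prop. 5 and Cor. 3; Ch. IV §1; Ch. XIV §3 (local symbols).
* [Flicker1998UnitaryFL] Y. Z. Flicker, *Elementary proof of the fundamental lemma for a unitary group*, Canad. J. Math. 50 (1998), Prop. 7 p. 84.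
* [Jacobowitz1962] R. Jacobowitz, *Hermitian forms over local fields*, Amer. J. Math. 84 (1962), §4.
-/

set_option autoImplicit false

open WithZero

namespace Summit.HodgeConjecture.HodgeConjecture.Cruxes.H413.F0P3cDyRamTopSideRamK

open Literature.NumberTheory.LocalFields.QuadraticOrder (exists_fixed_fixed_mul_of_eq_fixed_mul v_sub_one_le_of_theta_fixed)
open Literature.NumberTheory.LocalFields.WildQuadraticDatum (v_varpi_pow even_log_v_of_fixed)
open Summit.HodgeConjecture.HodgeConjecture.Cruxes.H413.F0P3cDyRamTopDepthRamK (v_eq_one_of_v_sub_one_le)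

variable {K : Type*} [Field K] [Valued K ℤᵐ⁰]

/-- `|x| = 1` from `|x·σx| = 1` for an isometric `σ`. [cite: Serre1979, Ch. V §3] -/
theorem v_eq_one_of_v_norm_eq_one {σ : K →+* K} (hσv : ∀ x, Valued.v (σ x) = Valued.v x) {x : K} (h : Valued.v (x * σ x) = 1) : Valued.v x = 1 := by
  rw [Valuation.map_mul, hσv] at h
  rcases lt_trichotomy (Valued.v x) 1 with h2 | h2 | h2
  · exfalso
    have hlt : Valued.v x * Valued.v x < 1 :=
      calc Valued.v x * Valued.v x ≤ Valued.v x * 1 := by gcongr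
        _ < 1 := by rw [mul_one]; exact h2
    rw [h] at hlt; exact lt_irrefl _ hlt
  · exact h2
  · exfalso
    have hlt : 1 < Valued.v x * Valued.v x :=
      calc (1 : ℤᵐ⁰) < Valued.v x := h2
        _ = Valued.v x * 1 := (mul_one _).symm
        _ ≤ Valued.v x * Valued.v x := by gcongr
    rw [h] at hlt; exact lt_irrefl _ hlt

/-- **MONOTONICITY**: ALIVE at depth `c₂` implies ALIVE at every `c₁ ≤ c₂`. [cite: Flicker1998UnitaryFL, p. 84] -/
theorem alive_mono {ρ Θ : K →+* K} {z : K} {c₁ c₂ : ℕ} (h12 : c₁ ≤ c₂)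
    (halive : ∃ x e w : K, Valued.v x = 1 ∧ ρ e = e ∧ Valued.v e = 1 ∧ Valued.v (w - 1) ≤ exp (-(c₂ : ℤ)) ∧ z = x * Θ x * e * w) :
    ∃ x e w : K, Valued.v x = 1 ∧ ρ e = e ∧ Valued.v e = 1 ∧ Valued.v (w - 1) ≤ exp (-(c₁ : ℤ)) ∧ z = x * Θ x * e * w := by
  obtain ⟨x, e, w, hx, hρe, he, hw, hz⟩ := halive
  exact ⟨x, e, w, hx, hρe, he, hw.trans (by rw [exp_le_exp]; omega), hz⟩

/-! ## §1 Near cells: TOP ⇒ ALIVE when a non-norm unit sits within `exp(−c)` of `1` -/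

/-- **NEAR CELLS ARE ALIVE ON BOTH SIDES.**  `Θ` isometric; the unit norm dichotomy (`hdich`: a `Θ`-fixed unit `c₀` such that every `Θ`-fixed unit `u` is a norm `xΘx` or `c₀u` is);
a `Θ`-fixed unit NON-norm `n₀` with `|n₀ − 1| ≤ exp(−c)` (exists iff `c ≤ 2d − 2`, ★ `exists_fixed_unit_not_norm_of_level_pow`).  Then TOP(z, c) ⇒ ALIVE(z, c): if `k` is not a
norm, `k∕n₀ = N(x₁)∕N(x₂)` is, and `n₀` joins `w`.  Apply it to `z₊` and to `z₊·n₀·e₀` alike. [cite: Serre1979, Ch. V §3 Cor. 3] [cite: Flicker1998UnitaryFL, p. 84] -/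
theorem alive_of_topDecomp_of_nonNorm_near {ρ Θ : K →+* K} (hΘv : ∀ x, Valued.v (Θ x) = Valued.v x)
    (hdich : ∃ c₀ : K, Θ c₀ = c₀ ∧ Valued.v c₀ = 1 ∧ ∀ u : K, Θ u = u → Valued.v u = 1 → (∃ x : K, x * Θ x = u) ∨ ∃ x : K, x * Θ x = c₀ * u)
    {n₀ : K} (hΘn : Θ n₀ = n₀) (hn1 : Valued.v n₀ = 1) (hnn : ¬ ∃ x : K, x * Θ x = n₀) {c : ℕ} (hnc : Valued.v (n₀ - 1) ≤ exp (-(c : ℤ)))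
    {z : K} (htop : ∃ k e w : K, Θ k = k ∧ Valued.v k = 1 ∧ ρ e = e ∧ Valued.v e = 1 ∧ Valued.v (w - 1) ≤ exp (-(c : ℤ)) ∧ z = k * e * w) :
    ∃ x e w : K, Valued.v x = 1 ∧ ρ e = e ∧ Valued.v e = 1 ∧ Valued.v (w - 1) ≤ exp (-(c : ℤ)) ∧ z = x * Θ x * e * w := by
  obtain ⟨k, e, w, hΘk, hvk, hρe, hve, hw, hz⟩ := htop
  obtain ⟨c₀, -, hc₀1, hd⟩ := hdich
  rcases hd k hΘk hvk with ⟨x, hx⟩ | ⟨x₁, hx₁⟩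
  · exact ⟨x, e, w, v_eq_one_of_v_norm_eq_one hΘv (by rw [hx, hvk]), hρe, hve, hw, by rw [hz, hx]⟩
  · -- `k` is not a norm: `c₀k = N(x₁)`, `c₀n₀ = N(x₂)`, so `k∕n₀ = N(x₁∕x₂)`
    obtain ⟨x₂, hx₂⟩ : ∃ x : K, x * Θ x = c₀ * n₀ := (hd n₀ hΘn hn1).resolve_left hnn
    have hn0 : n₀ ≠ 0 := fun h0 => by rw [h0, map_zero] at hn1; exact zero_ne_one hn1
    have hvx₁ : Valued.v x₁ = 1 := v_eq_one_of_v_norm_eq_one hΘv (by rw [hx₁, Valuation.map_mul, hc₀1, hvk, mul_one])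
    have hvx₂ : Valued.v x₂ = 1 := v_eq_one_of_v_norm_eq_one hΘv (by rw [hx₂, Valuation.map_mul, hc₀1, hn1, mul_one])
    have hx₂0 : x₂ ≠ 0 := fun h0 => by rw [h0, map_zero] at hvx₂; exact zero_ne_one hvx₂
    have hΘx₂0 : Θ x₂ ≠ 0 := (map_ne_zero Θ).2 hx₂0
    have hc₀0 : c₀ ≠ 0 := fun h0 => by rw [h0, map_zero] at hc₀1; exact zero_ne_one hc₀1
    have hkn : k = (x₁ / x₂) * Θ (x₁ / x₂) * n₀ := by
      rw [map_div₀, div_mul_div_comm, hx₁, hx₂]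
      field_simp
    refine ⟨x₁ / x₂, e, n₀ * w, by rw [map_div₀, hvx₁, hvx₂, div_one], hρe, hve, ?_, ?_⟩
    · have h1 : n₀ * w - 1 = n₀ * (w - 1) + (n₀ - 1) := by ring
      rw [h1]
      refine (Valuation.map_add _ _ _).trans (max_le ?_ hnc)
      rw [Valuation.map_mul, hn1, one_mul]; exact hw
    · rw [hz, hkn]; ring

/-! ## §2 Far cells: exclusivity -/

/-- **FAR CELLS LIVE ON AT MOST ONE SIDE.**  Frame: `Θ` involutive, commuting with `ρ`, both isometric; `ϖE` a `ρ`-fixed uniformiser with `ΘϖE ≠ ϖE`; `Θ`-fixed non-zero elements of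
even valuation; the RamK norm suppliers `hNF` (`𝒪_Fˣ ⊆ N`) and `hNd` (`U_{K♮}^{(d)} ⊆ N`), `1 ≤ d`; a far depth `2d ≤ c + 1`.  If `n₀` is a `Θ`-fixed unit NON-norm and `e₀` a `ρ`-fixed unit, then
ALIVE(z, c) and ALIVE(z·n₀·e₀, c) are not both true: the quotient would exhibit `n₀ ∈ N·(𝒪_{K♮}ˣ ∩ 𝒪_EˣU^{(c)}) = N·𝒪_FˣU_{K♮}^{(⌈c∕2⌉)} ⊆ N` (★ (M-RK1)).  [«(X-RK) exclusivity»: with the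
hyperbolic unit `z₊` and the other line model's unit `z₊·n₀·e₀`, the far cells of ★ `toricCensusSum_ramK` carry the factor `2` on ONE side.] [cite: Serre1979, Ch. V §3 Cor. 3; Ch. IV §1]
[cite: Flicker1998UnitaryFL, p. 84] [cite: Jacobowitz1962, §4] -/
theorem not_alive_and_alive_mul_nonNorm {ρ Θ : K →+* K} (hΘΘ : ∀ x, Θ (Θ x) = x) (hρΘ : ∀ x, ρ (Θ x) = Θ (ρ x))
    (hΘv : ∀ x, Valued.v (Θ x) = Valued.v x)
    {ϖE : K} (hϖE : Valued.v ϖE = exp (-1 : ℤ)) (hρϖ : ρ ϖE = ϖE) (hΘϖ : Θ ϖE ≠ ϖE)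
    (hΘev : ∀ x : K, Θ x = x → x ≠ 0 → ∃ n : ℤ, Valued.v x = exp (2 * n))
    {d : ℕ} (hd : 1 ≤ d)
    (hNF : ∀ f : K, ρ f = f → Θ f = f → Valued.v f = 1 → ∃ x : K, x * Θ x = f)
    (hNd : ∀ u : K, Θ u = u → Valued.v (u - 1) ≤ Valued.v ϖE ^ (2 * d) → ∃ x : K, x * Θ x = u)
    {n₀ e₀ : K} (hΘn : Θ n₀ = n₀) (hnn : ¬ ∃ x : K, x * Θ x = n₀) (hρe₀ : ρ e₀ = e₀) (he₀1 : Valued.v e₀ = 1)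
    {z : K} {c : ℕ} (hdc : 2 * d ≤ c + 1)
    (h₁ : ∃ x e w : K, Valued.v x = 1 ∧ ρ e = e ∧ Valued.v e = 1 ∧ Valued.v (w - 1) ≤ exp (-(c : ℤ)) ∧ z = x * Θ x * e * w)
    (h₂ : ∃ x e w : K, Valued.v x = 1 ∧ ρ e = e ∧ Valued.v e = 1 ∧ Valued.v (w - 1) ≤ exp (-(c : ℤ)) ∧ z * n₀ * e₀ = x * Θ x * e * w) : False := by
  have hπ : ∀ n : ℕ, Valued.v ϖE ^ n = exp (-(n : ℤ)) := v_varpi_pow hϖE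
  have hfix : ∀ a : K, Θ a = a → a ≠ 0 → Even (log (Valued.v a)) := even_log_v_of_fixed hΘev
  have hΘρ : ∀ x, Θ (ρ x) = ρ (Θ x) := fun x => (hρΘ x).symm
  have hc : 1 ≤ c := by omega
  obtain ⟨x, e, w, hvx, hρe, hve, hw, hz⟩ := h₁
  obtain ⟨x', e', w', hvx', hρe', hve', hw', hz'⟩ := h₂
  have hvw : Valued.v w = 1 := v_eq_one_of_v_sub_one_le hc hw
  have hvw' : Valued.v w' = 1 := v_eq_one_of_v_sub_one_le hc hw'
  have hx0 : x ≠ 0 := fun h0 => by rw [h0, map_zero] at hvx; exact zero_ne_one hvx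
  have hΘx0 : Θ x ≠ 0 := (map_ne_zero Θ).2 hx0
  have he0 : e ≠ 0 := fun h0 => by rw [h0, map_zero] at hve; exact zero_ne_one hve
  have hw0 : w ≠ 0 := fun h0 => by rw [h0, map_zero] at hvw; exact zero_ne_one hvw
  have he₀0 : e₀ ≠ 0 := fun h0 => by rw [h0, map_zero] at he₀1; exact zero_ne_one he₀1
  have hx'0 : x' ≠ 0 := fun h0 => by rw [h0, map_zero] at hvx'; exact zero_ne_one hvx'
  have hΘx'0 : Θ x' ≠ 0 := (map_ne_zero Θ).2 hx'0
  -- `u₀ := n₀ ∕ N(x'∕x)` is a `Θ`-fixed unit equal to `(e'∕(e e₀))·(w'∕w)`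
  set u₀ := n₀ / (x' / x * Θ (x' / x)) with hu₀
  have hΘu₀ : Θ u₀ = u₀ := by rw [hu₀, map_div₀, map_mul, hΘΘ, hΘn, mul_comm (Θ (x' / x)) (x' / x)]
  have hu₀eq : u₀ = (e' / (e * e₀)) * (w' / w) := by
    have h : x * Θ x * e * w * n₀ * e₀ = x' * Θ x' * e' * w' := by rw [← hz, hz']
    rw [hu₀, map_div₀]
    field_simp
    linear_combination h
  have hρee : ρ (e' / (e * e₀)) = e' / (e * e₀) := by rw [map_div₀, map_mul, hρe', hρe, hρe₀]
  have hvee : Valued.v (e' / (e * e₀)) = 1 := by rw [map_div₀, Valuation.map_mul, hve', hve, he₀1, mul_one, div_one]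
  have hww : Valued.v (w' / w - 1) ≤ exp (-(c : ℤ)) := by
    have h : w' / w - 1 = ((w' - 1) - (w - 1)) / w := by field_simp; ring
    rw [h, map_div₀, hvw, div_one]
    exact (Valuation.map_sub _ _ _).trans (max_le hw' hw)
  obtain ⟨f, w'', hρf, hΘf, hvf, hΘw'', hw'', hu₀fw⟩ :=
    exists_fixed_fixed_mul_of_eq_fixed_mul hΘΘ hΘρ hΘv hfix hρϖ hϖE hΘϖ hΘu₀ hρee hvee hww hu₀eq
  have hw''d : Valued.v (w'' - 1) ≤ Valued.v ϖE ^ (2 * d) := by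
    refine (v_sub_one_le_of_theta_fixed hfix hΘw'' hw'').trans ?_
    rw [hπ, exp_le_exp]; omega
  obtain ⟨y₁, hy₁⟩ := hNF f hρf hΘf hvf
  obtain ⟨y₂, hy₂⟩ := hNd w'' hΘw'' hw''d
  apply hnn
  refine ⟨x' / x * y₁ * y₂, ?_⟩
  have hN0 : x' / x * Θ (x' / x) ≠ 0 := mul_ne_zero (div_ne_zero hx'0 hx0) (by rw [map_div₀]; exact div_ne_zero hΘx'0 hΘx0)
  have hn : n₀ = x' / x * Θ (x' / x) * u₀ := by rw [hu₀, mul_div_cancel₀ _ hN0]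
  rw [hn, hu₀fw, ← hy₁, ← hy₂, map_mul, map_mul]; ring

/-! ## §3 Far cells: constancy of the side along the diagonal -/

/-- **THE SIDE IS CONSTANT ALONG THE DIAGONAL.**  Frame as §2.  If `2d ≤ c₁ + 1`, `c₁ ≤ c₂`, ALIVE(z, c₁) and TOP(z, c₂), then ALIVE(z, c₂): from `z = N(x)·e₁·w₁ = k₂·e₂·w₂` the
`Θ`-fixed unit `k₂∕N(x)` lies in `𝒪_EˣU^{(c₁)}`, hence (★ (M-RK1), `hNF`, `hNd`) in `N`, so `k₂ ∈ N`.  With `alive_mono` the side at EVERY far depth where TOP holds equals the side at any one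
of them — in particular at the depth `c₀ ≤ m_λ − t` where ★ p857819 §4 makes the decomposition explicit. [cite: Serre1979, Ch. V §3 Cor. 3; Ch. IV §1] [cite: Flicker1998UnitaryFL, p. 84] -/
theorem alive_of_alive_of_topDecomp {ρ Θ : K →+* K} (hΘΘ : ∀ x, Θ (Θ x) = x) (hρΘ : ∀ x, ρ (Θ x) = Θ (ρ x))
    (hΘv : ∀ x, Valued.v (Θ x) = Valued.v x)
    {ϖE : K} (hϖE : Valued.v ϖE = exp (-1 : ℤ)) (hρϖ : ρ ϖE = ϖE) (hΘϖ : Θ ϖE ≠ ϖE)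
    (hΘev : ∀ x : K, Θ x = x → x ≠ 0 → ∃ n : ℤ, Valued.v x = exp (2 * n))
    {d : ℕ} (hd : 1 ≤ d)
    (hNF : ∀ f : K, ρ f = f → Θ f = f → Valued.v f = 1 → ∃ x : K, x * Θ x = f)
    (hNd : ∀ u : K, Θ u = u → Valued.v (u - 1) ≤ Valued.v ϖE ^ (2 * d) → ∃ x : K, x * Θ x = u)
    {z : K} {c₁ c₂ : ℕ} (hdc : 2 * d ≤ c₁ + 1) (h12 : c₁ ≤ c₂)
    (h₁ : ∃ x e w : K, Valued.v x = 1 ∧ ρ e = e ∧ Valued.v e = 1 ∧ Valued.v (w - 1) ≤ exp (-(c₁ : ℤ)) ∧ z = x * Θ x * e * w)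
    (h₂ : ∃ k e w : K, Θ k = k ∧ Valued.v k = 1 ∧ ρ e = e ∧ Valued.v e = 1 ∧ Valued.v (w - 1) ≤ exp (-(c₂ : ℤ)) ∧ z = k * e * w) :
    ∃ x e w : K, Valued.v x = 1 ∧ ρ e = e ∧ Valued.v e = 1 ∧ Valued.v (w - 1) ≤ exp (-(c₂ : ℤ)) ∧ z = x * Θ x * e * w := by
  have hπ : ∀ n : ℕ, Valued.v ϖE ^ n = exp (-(n : ℤ)) := v_varpi_pow hϖE
  have hfix : ∀ a : K, Θ a = a → a ≠ 0 → Even (log (Valued.v a)) := even_log_v_of_fixed hΘev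
  have hΘρ : ∀ x, Θ (ρ x) = ρ (Θ x) := fun x => (hρΘ x).symm
  have hc₁ : 1 ≤ c₁ := by omega
  obtain ⟨x, e₁, w₁, hvx, hρe₁, hve₁, hw₁, hz₁⟩ := h₁
  obtain ⟨k, e₂, w₂, hΘk, hvk, hρe₂, hve₂, hw₂, hz₂⟩ := h₂
  have hvw₁ : Valued.v w₁ = 1 := v_eq_one_of_v_sub_one_le hc₁ hw₁
  have hvw₂ : Valued.v w₂ = 1 := v_eq_one_of_v_sub_one_le (hc₁.trans h12) hw₂
  have hx0 : x ≠ 0 := fun h0 => by rw [h0, map_zero] at hvx; exact zero_ne_one hvx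
  have hΘx0 : Θ x ≠ 0 := (map_ne_zero Θ).2 hx0
  have he₂0 : e₂ ≠ 0 := fun h0 => by rw [h0, map_zero] at hve₂; exact zero_ne_one hve₂
  have hw₂0 : w₂ ≠ 0 := fun h0 => by rw [h0, map_zero] at hvw₂; exact zero_ne_one hvw₂
  -- `u₀ := k ∕ N(x) = (e₁∕e₂)·(w₁∕w₂)`, a `Θ`-fixed unit of `𝒪_EˣU^{(c₁)}`
  set u₀ := k / (x * Θ x) with hu₀
  have hΘu₀ : Θ u₀ = u₀ := by rw [hu₀, map_div₀, map_mul, hΘΘ, hΘk, mul_comm (Θ x) x]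
  have hu₀eq : u₀ = (e₁ / e₂) * (w₁ / w₂) := by
    have h : x * Θ x * e₁ * w₁ = k * e₂ * w₂ := by rw [← hz₁, hz₂]
    rw [hu₀, div_eq_iff (mul_ne_zero hx0 hΘx0)]
    field_simp
    linear_combination -h
  have hρee : ρ (e₁ / e₂) = e₁ / e₂ := by rw [map_div₀, hρe₁, hρe₂]
  have hvee : Valued.v (e₁ / e₂) = 1 := by rw [map_div₀, hve₁, hve₂, div_one]
  have hww : Valued.v (w₁ / w₂ - 1) ≤ exp (-(c₁ : ℤ)) := by
    have h : w₁ / w₂ - 1 = ((w₁ - 1) - (w₂ - 1)) / w₂ := by field_simp; ring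
    rw [h, map_div₀, hvw₂, div_one]
    exact (Valuation.map_sub _ _ _).trans (max_le hw₁ (hw₂.trans (by rw [exp_le_exp]; omega)))
  obtain ⟨f, w'', hρf, hΘf, hvf, hΘw'', hw'', hu₀fw⟩ :=
    exists_fixed_fixed_mul_of_eq_fixed_mul hΘΘ hΘρ hΘv hfix hρϖ hϖE hΘϖ hΘu₀ hρee hvee hww hu₀eq
  have hw''d : Valued.v (w'' - 1) ≤ Valued.v ϖE ^ (2 * d) := by
    refine (v_sub_one_le_of_theta_fixed hfix hΘw'' hw'').trans ?_
    rw [hπ, exp_le_exp]; omega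
  obtain ⟨y₁, hy₁⟩ := hNF f hρf hΘf hvf
  obtain ⟨y₂, hy₂⟩ := hNd w'' hΘw'' hw''d
  have hk : k = (x * y₁ * y₂) * Θ (x * y₁ * y₂) := by
    have h1 : k = x * Θ x * u₀ := by rw [hu₀, mul_div_cancel₀ _ (mul_ne_zero hx0 hΘx0)]
    rw [h1, hu₀fw, ← hy₁, ← hy₂, map_mul, map_mul]; ring
  refine ⟨x * y₁ * y₂, e₂, w₂, v_eq_one_of_v_norm_eq_one hΘv (by rw [← hk, hvk]), hρe₂, hve₂, hw₂, by rw [hz₂, hk]⟩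

end Summit.HodgeConjecture.HodgeConjecture.Cruxes.H413.F0P3cDyRamTopSideRamK
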